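import Summits.AnomalousDissipation.AnomalousDissipation.Theses.LimitingAbsorption
import Summits.AnomalousDissipation.AnomalousDissipation.Theorems.TwoAndHalfDScalarLiftGlue
import Literature.Analysis.FluidPDE.LongTimeAverageShift
import Literature.Analysis.FluidPDE.PassiveScalarForcedClass
import Summits.AnomalousDissipation.AnomalousDissipation.Theorems.TwoAndHalfDScalarLift2halfDR
import Summits.AnomalousDissipation.AnomalousDissipation.Theorems.LimitingAbsorptionKinematicSteadySourceLawToolkit
import HarnessLib

/-!
# Route LimitingAbsorption — crux `ScalarSectorLift` (stmt-AnomalousDissipation-2941)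

`Summit.AnomalousDissipation.AnomalousDissipation.Theses.LimitingAbsorption.ScalarSectorLift`:
a scalar-sector witness on `T²` — a steady smooth divergence-free mean-zero planar force `g`, a
smooth mean-zero source profile `h`, viscosities `νⱼ → 0`, global Leray–Hopf solutions `vⱼ` of
2-D Navier–Stokes forced by `g` which are bounded on every `(0,T) × T²`, weak `h`-sourced scalars
`θⱼ` over `vⱼ` from `L²` data `θ₀ⱼ`, bounded limsup-mean energies of `vⱼ` and `θⱼ`, and a
uniform floor `ε > 0` under the limsup-mean scalar dissipation `νⱼ‖∇θⱼ‖²` — implies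
`AnomalousDissipation` (`Literature.Turb.ZerothLaw` on `T³`).

## Proof (line `sibling-lift-transfer`: the 2½-D lift of the sibling route, restart form)

This is the bookkeeping of `Theorems.scalarLiftGlueR_proof` (route TwoAndHalfD,
`Theorems/TwoAndHalfDScalarLiftGlueR.lean`) with its one uniqueness call replaced.

* For each `j`, the PROVED repaired lift `Theorems.scalarLift2halfDR_proof`
  (`TwoAndHalfD.ScalarLift2halfDR`) applied to `(νⱼ, g, h, v₀ⱼ, vⱼ, θ₀ⱼ)` gives a weak sourced
  scalar `θ̃ⱼ` from `θ₀ⱼ` over `vⱼ` and a restart time `sⱼ ≥ 0` such that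
  `uⱼ(t) := (vⱼ(t+sⱼ), θ̃ⱼ(t+sⱼ)) ∘ π` (`Torus.twoHalf`) is a global Leray–Hopf solution on `T³`
  with viscosity `νⱼ`, steady force `f := (g, h) ∘ π` and honest datum `(vⱼ sⱼ, θ̃ⱼ sⱼ) ∘ π`
  (the possibly junk planar datum `v₀ⱼ` is never read).
* UNIQUENESS FOR BOUNDED DRIFT (the one place where this crux is easier than the sibling glue,
  which needs the open item `SourcedScalarUnique2D`): since `vⱼ ∈ L^∞((0,T) × T²)` for every
  `T`, `Theorems.KinematicSteadySourceLaw.forced_ae_eq_of_memLp_top` gives `θ̃ⱼ t = θⱼ t` a.e. in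
  `x` for a.e. `t ∈ (0,T)`, on the ORIGINAL time axis; Lebesgue measure being translation
  invariant, also `θ̃ⱼ(t+sⱼ) = θⱼ(t+sⱼ)` for a.e. `t ∈ (0,T]` (`ae_restrict_Ioc_comp_add_right`).
* `f` is smooth, divergence-free and mean-zero (`IsSmooth.twoHalf`, `IsDivFree.twoHalf`,
  `hasZeroMean_twoHalf`).
* MEAN ENERGY: `‖uⱼ(t)‖² = ‖vⱼ(t+sⱼ)‖² + ‖θ̃ⱼ(t+sⱼ)‖²` for `t ≥ 0`
  (`integral_norm_sq_twoHalf_of_memLp`); the running means of `‖uⱼ‖²` are those of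
  `‖vⱼ(·+sⱼ)‖² + ‖θⱼ(·+sⱼ)‖²`; junk-robust subadditivity (`longTimeAvgSup_add_le_add`) and
  translation invariance of long-time averages (`IsGlobalLerayHopf.meanEnergy_translate`,
  `longTimeAvgSup_comp_add_right`, local integrability of `t ↦ ‖θⱼ t‖²` from the weak class,
  `forced_integrableOn_scalarL2Sq`) give `meanEnergy uⱼ ≤ E_v + E_θ`.
* MEAN DISSIPATION: `ε > 0` below `⟨νⱼ‖∇θⱼ‖²⟩` forces local integrability of the scalar
  dissipation (`integrableOn_Ioc_of_longTimeAvgSup_ne_zero`), so its long-time average does not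
  see the translation; a.e. in time `νⱼ‖∇θⱼ(t+sⱼ)‖² = νⱼ‖∇θ̃ⱼ(t+sⱼ)‖² ≤ νⱼ‖∇uⱼ(t)‖²`
  (`eScalarGradNormSq_congr_ae`, `Torus.eGradNormSq_twoHalf`), the lift's running means are
  bounded (Doering–Foias, `Torus.IsLerayHopfOn.intervalIntegral_power_bounds`), whence
  `ε ≤ meanDissipation νⱼ uⱼ` (`Filter.limsup_le_limsup`).

## References

* E. Bruè, C. De Lellis, *Anomalous dissipation for the forced 3D Navier–Stokes equations*,
  Comm. Math. Phys. 400 (2023), §3 (the `2½`-dimensional architecture). [`BrueDeLellis2023`]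
* A. Cheskidov, *Dissipation anomaly and anomalous dissipation in incompressible fluid flows*,
  arXiv:2311.04182 (2023), §3, Lemma 3.2. [`Cheskidov2023`]
* A. J. Majda, A. L. Bertozzi, *Vorticity and Incompressible Flow* (2002), §2.3.1.
* T. Drivas, T. Elgindi, G. Iyer, I.-J. Jeong, ARMA 243 (2022), (1.3) (energy balance ⇒
  uniqueness for bounded drift). [`DEIJ2022`]
* C. R. Doering, C. Foias, J. Fluid Mech. 467 (2002), §2 (long-time averages).
-/

noncomputable section

open MeasureTheory Set Filter Topology Function
open scoped ENNReal NNReal InnerProductSpace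
open Literature.Analysis.FunctionSpaces Literature.Analysis.FunctionSpaces.Torus
open Literature.Analysis.FluidPDE Literature.Analysis.FluidPDE.Torus

namespace Summit.AnomalousDissipation.AnomalousDissipation.Theorems

-- D-0017: single-problem summit ⇒ `Summit.AnomalousDissipation.AnomalousDissipation.…` by design.
set_option linter.dupNamespace false

/-! ### Translation bookkeeping on the time axis (local copies)

The four `private` lemmas below are verbatim the public helpers of
`Theorems/TwoAndHalfDScalarLiftGlueR.lean` (`ae_restrict_Ioc_comp_add_right`,
`integrableOn_Ioc_comp_add_right`, `integrableOn_Ioc_of_longTimeAvgSup_ne_zero`,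
`forced_integrableOn_scalarL2Sq`); they are kept private here so that this file does not depend
on that module. -/

/-- An a.e. statement on `(0, T + s]` transfers to the translate by `s ≥ 0` on `(0, T]`
(Lebesgue measure is translation invariant, and `t ∈ (0, T] ⇒ t + s ∈ (0, T + s]`).
[folklore] -/
private theorem ssl_ae_restrict_Ioc_comp_add_right {p : ℝ → Prop} {T s : ℝ} (hs : 0 ≤ s)
    (h : ∀ᵐ t ∂(volume.restrict (Ioc 0 (T + s))), p t) :
    ∀ᵐ t ∂(volume.restrict (Ioc 0 T)), p (t + s) := by
  rw [ae_restrict_iff' measurableSet_Ioc] at h ⊢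
  have h2 : ∀ᵐ t ∂(volume : Measure ℝ), t + s ∈ Ioc 0 (T + s) → p (t + s) :=
    (measurePreserving_add_right volume s).quasiMeasurePreserving.ae h
  filter_upwards [h2] with t ht htmem
  exact ht ⟨by linarith [htmem.1], by linarith [htmem.2]⟩

/-- Integrability on `(0, T + s]` gives integrability of the translate by `s ≥ 0` on `(0, T]`
(translation invariance of Lebesgue measure; `(0, T] + s = (s, T + s] ⊆ (0, T + s]`).
[folklore] -/
private theorem ssl_integrableOn_Ioc_comp_add_right {φ : ℝ → ℝ} {T s : ℝ} (hs : 0 ≤ s)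
    (h : IntegrableOn φ (Ioc 0 (T + s))) : IntegrableOn (fun t => φ (t + s)) (Ioc 0 T) := by
  have A : MeasurableEmbedding fun x : ℝ => x + s :=
    (Homeomorph.addRight s).isClosedEmbedding.measurableEmbedding
  have h' : IntegrableOn φ (Ioc s (T + s)) := h.mono_set (Ioc_subset_Ioc_left hs)
  rw [← map_add_right_eq_self volume s, MeasurableEmbedding.integrableOn_map_iff A] at h'
  have hpre : (fun x : ℝ => x + s) ⁻¹' Ioc s (T + s) = Ioc 0 T := by
    rw [Set.preimage_add_const_Ioc, sub_self, add_sub_cancel_right]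
  rw [hpre] at h'
  exact h'

/-- **Junk bookkeeping.** If the long-time average `⟨G⟩ = limsup_T T⁻¹∫₀ᵀ G` is not `0`, then
`G` is integrable on every `(0, T]`: otherwise `G` fails to be integrable on `(0, T']` for every
`T' ≥ T`, every such running mean is the Bochner junk value `0`, and so is the `limsup`.
[folklore] -/
private theorem ssl_integrableOn_Ioc_of_longTimeAvgSup_ne_zero {G : ℝ → ℝ}
    (h : longTimeAvgSup G ≠ 0) (T : ℝ) : IntegrableOn G (Ioc 0 T) := by
  by_contra hG
  apply h
  have hev : timeMean G =ᶠ[atTop] fun _ => (0 : ℝ) := by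
    filter_upwards [eventually_ge_atTop T, eventually_ge_atTop (0 : ℝ)] with T' hT' hT'0
    have hG' : ¬ IntegrableOn G (Ioc 0 T') := fun hi =>
      hG (hi.mono_set (Ioc_subset_Ioc_right hT'))
    unfold timeMean
    rw [intervalIntegral.integral_of_le hT'0, integral_undef hG', mul_zero]
  unfold longTimeAvgSup
  rw [limsup_congr hev, limsup_const]

/-- **The weak class controls the scalar energy in time.** For a weak sourced scalar
`θ ∈ L^∞(0,T; L²)` (`Torus.IsWeakScalarTransportForcedOn`), `t ↦ ‖θ(t)‖²_{L²}` is integrable on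
`(0, T]`: it is a.e.-strongly measurable by Fubini (joint measurability of `θ`) and a.e. bounded
by the `L^∞_t L²_x` constant. [folklore] -/
private theorem ssl_forced_integrableOn_scalarL2Sq {d : Type*} [Fintype d] {T κ : ℝ}
    {u : ℝ → UnitAddTorus d → EuclideanSpace ℝ d} {src : ℝ → UnitAddTorus d → ℝ}
    {θ₀ : UnitAddTorus d → ℝ} {θ : ℝ → UnitAddTorus d → ℝ}
    (hw : IsWeakScalarTransportForcedOn T κ u src θ₀ θ) :
    IntegrableOn (fun t => scalarL2Sq (θ t)) (Ioc 0 T) := by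
  rw [integrableOn_Ioc_iff_integrableOn_Ioo]
  obtain ⟨C, hC⟩ := hw.ae_lintegral_sq_le
  have hm := hw.aestronglyMeasurable_uncurry
  have hmeas : AEStronglyMeasurable (fun t => scalarL2Sq (θ t)) (volume.restrict (Ioo 0 T)) := by
    have h2 : AEStronglyMeasurable (fun p : ℝ × UnitAddTorus d => (uncurry θ p) ^ 2)
        (((volume : Measure ℝ).restrict (Ioo 0 T)).prod volume) := hm.pow 2
    exact h2.integral_prod_right'
  refine Integrable.mono' (g := fun _ => (C : ℝ)) (integrableOn_const (hs := measure_Ioo_lt_top.ne))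
    hmeas ?_
  filter_upwards [hC, hm.prodMk_left] with t ht hmt
  rw [Real.norm_eq_abs, abs_of_nonneg (scalarL2Sq_nonneg _)]
  have hst : AEStronglyMeasurable (fun x => θ t x ^ 2) volume := hmt.pow 2
  change ∫ x, θ t x ^ 2 ≤ (C : ℝ)
  rw [integral_eq_lintegral_of_nonneg_ae (Eventually.of_forall fun x => sq_nonneg (θ t x)) hst]
  have hlin : ∫⁻ x, ENNReal.ofReal (θ t x ^ 2) = ∫⁻ x, ‖θ t x‖ₑ ^ 2 := by
    refine lintegral_congr fun x => ?_
    rw [Real.enorm_eq_ofReal_abs, ← ENNReal.ofReal_pow (abs_nonneg _), sq_abs]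
  rw [hlin, ← ENNReal.coe_toReal C]
  exact ENNReal.toReal_mono ENNReal.coe_ne_top ht


/-- **Crux `ScalarSectorLift` (stmt-AnomalousDissipation-2941, route LimitingAbsorption).**
A scalar-sector witness on `T²` (steady smooth divergence-free mean-zero `g`, smooth mean-zero
`h`, `νⱼ → 0`, locally bounded global Leray–Hopf `vⱼ` forced by `g`, weak `h`-sourced scalars
`θⱼ` from `L²` data, bounded limsup-mean energies, limsup-mean `νⱼ‖∇θⱼ‖² ≥ ε > 0`) implies
`AnomalousDissipation`. Proof: see the module docstring — the witness of the zeroth law is the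
translated `2½`-dimensional lift `(vⱼ, θ̃ⱼ)(· + sⱼ) ∘ π` of the sibling route's repaired lift
`scalarLift2halfDR_proof`, the given scalar `θⱼ` being identified with the lift's scalar `θ̃ⱼ`
a.e. by bounded-drift uniqueness (`KinematicSteadySourceLaw.forced_ae_eq_of_memLp_top`); the
long-time averages are then handled exactly as in `scalarLiftGlueR_proof`.
[cite: BrueDeLellis2023, §3] [cite: Cheskidov2023, §3 Lemma 3.2] [cite: DEIJ2022, (1.3)] -/
theorem scalarSectorLift_proof :
    Summit.AnomalousDissipation.AnomalousDissipation.Theses.LimitingAbsorption.ScalarSectorLift := by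
  unfold Summit.AnomalousDissipation.AnomalousDissipation.Theses.LimitingAbsorption.ScalarSectorLift
  rintro ⟨g, h, hg, hgd, hg0, hh, hh0, ν, v₀, v, θ₀, θ, hν, hν0, hLHv, hbd, hθ₀, hθW, ⟨Ev, hEv⟩,
    ⟨Eθ, hEθ⟩, ε, hε, hεle⟩
  -- the sibling route's repaired lift, as a `∀`-statement
  have hL := scalarLift2halfDR_proof
  unfold Summit.AnomalousDissipation.AnomalousDissipation.Theses.TwoAndHalfD.ScalarLift2halfDR at hL
  -- the weak sourced solutions `θ' j`, the restart times `s j` and the translated lifts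
  choose θ' hθ'W s hs hθ'LH using
    fun j => hL (ν j) g h (v₀ j) (v j) (θ₀ j) (hν j) hg hgd hh (hθ₀ j) (hLHv j)
  -- the force
  have hfs : IsSmooth (twoHalf g h) := hg.twoHalf hh
  have hfd : IsDivFree (twoHalf g h) := hgd.twoHalf h
  have hfm : HasZeroMean (twoHalf g h) := hasZeroMean_twoHalf hg.integrable hh.integrable hg0 hh0
  have hf2 : MemLp (twoHalf g h) 2 volume := hfs.memLp 2
  -- uniqueness for bounded drift on the original axis: `θ' j t = θ j t` a.e. in `x`
  -- for a.e. `t ∈ (0, T]` …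
  have hae : ∀ j T, 0 < T → ∀ᵐ t ∂(volume.restrict (Ioc 0 T)), θ' j t =ᵐ[volume] θ j t := by
    intro j T hT
    rw [← restrict_Ioo_eq_restrict_Ioc]
    exact KinematicSteadySourceLaw.forced_ae_eq_of_memLp_top (hν j) (hθ'W j T hT) (hθW j T hT)
      (hbd j T hT)
  -- … hence also along the translated axis
  have haeS : ∀ j T, 0 < T →
      ∀ᵐ t ∂(volume.restrict (Ioc 0 T)), θ' j (t + s j) =ᵐ[volume] θ j (t + s j) := by
    intro j T hT
    exact ssl_ae_restrict_Ioc_comp_add_right (p := fun t => θ' j t =ᵐ[volume] θ j t) (hs j)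
      (hae j (T + s j) (by linarith [hs j]))
  -- `L²` slices of the translates for `t ≥ 0`
  have hv2 : ∀ j t, 0 ≤ t → MemLp (v j (t + s j)) 2 volume := fun j t ht =>
    (hLHv j).memLp_two (by linarith [hs j])
  have hθ'2 : ∀ j t, 0 ≤ t → MemLp (θ' j (t + s j)) 2 volume := fun j t ht =>
    (memLp_of_twoHalf ((hθ'LH j).memLp_two ht)).2
  -- local integrability of the scalar energy `t ↦ ‖θ j t‖²` (weak class)
  have hθi : ∀ j T, 0 < T → IntegrableOn (fun t => scalarL2Sq (θ j t)) (Ioc 0 T) :=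
    fun j T hT => ssl_forced_integrableOn_scalarL2Sq (hθW j T hT)
  refine ⟨twoHalf g h, hfs, hfd, hfm, ν,
    fun j => twoHalf (v j (s j)) (θ' j (s j)),
    fun j t => twoHalf (v j (t + s j)) (θ' j (t + s j)), hν, hν0, hθ'LH,
    ⟨Ev + Eθ, fun j => ?_⟩, ⟨ε, hε, fun j => ?_⟩⟩
  · /- MEAN ENERGY: `⟨‖uⱼ‖²⟩ = ⟨‖vⱼ(·+sⱼ)‖² + ‖θⱼ(·+sⱼ)‖²⟩ ≤ E_v + E_θ` (junk-robust). -/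
    have hLHu := hθ'LH j
    -- pointwise splitting of the energy for `t ≥ 0`
    have hsplit : ∀ t, 0 ≤ t → ∫ x, ‖twoHalf (v j (t + s j)) (θ' j (t + s j)) x‖ ^ 2 =
        (∫ y, ‖v j (t + s j) y‖ ^ 2) + scalarL2Sq (θ' j (t + s j)) := fun t ht =>
      integral_norm_sq_twoHalf_of_memLp (hv2 j t ht) (hθ'2 j t ht)
    -- a.e. in time the lift's scalar and the crux scalar have the same `L²` norm
    have haeE : ∀ T, 0 < T → ∀ᵐ t ∂(volume.restrict (Ioc 0 T)),
        scalarL2Sq (θ' j (t + s j)) = scalarL2Sq (θ j (t + s j)) := fun T hT =>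
      (haeS j T hT).mono fun t ht => scalarL2Sq_congr_ae ht
    -- integrability in time of the two energies on the right
    have hAi : ∀ T, 0 < T → IntegrableOn (fun t => ∫ y, ‖v j (t + s j) y‖ ^ 2) (Ioc 0 T) :=
      fun T hT => ssl_integrableOn_Ioc_comp_add_right (φ := fun t => ∫ y, ‖v j t y‖ ^ 2) (hs j)
        ((hLHv j).integrableOn_integral_norm_sq (by linarith [hs j]))
    have hBi : ∀ T, 0 < T → IntegrableOn (fun t => scalarL2Sq (θ j (t + s j))) (Ioc 0 T) :=
      fun T hT => ssl_integrableOn_Ioc_comp_add_right (φ := fun t => scalarL2Sq (θ j t)) (hs j)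
        (hθi j (T + s j) (by linarith [hs j]))
    -- the running means of `‖uⱼ‖²` are those of `‖vⱼ(·+sⱼ)‖² + ‖θⱼ(·+sⱼ)‖²`
    have hmean : timeMean (fun t => ∫ x, ‖twoHalf (v j (t + s j)) (θ' j (t + s j)) x‖ ^ 2)
        =ᶠ[atTop] timeMean (fun t => (∫ y, ‖v j (t + s j) y‖ ^ 2) + scalarL2Sq (θ j (t + s j))) := by
      filter_upwards [eventually_gt_atTop (0 : ℝ)] with T hT
      refine timeMean_congr_ae hT.le ?_
      filter_upwards [haeE T hT, ae_restrict_mem measurableSet_Ioc] with t ht htmem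
      rw [hsplit t htmem.1.le, ht]
    -- the two bounds: translation invariance of long-time averages
    have hEA : longTimeAvgSup (fun t => ∫ y, ‖v j (t + s j) y‖ ^ 2) ≤ Ev := by
      rw [← meanEnergy_eq_longTimeAvgSup (fun t => v j (t + s j)),
        (hLHv j).meanEnergy_translate (hs j)]
      exact hEv j
    have hEB : longTimeAvgSup (fun t => scalarL2Sq (θ j (t + s j))) ≤ Eθ := by
      rw [longTimeAvgSup_comp_add_right (φ := fun t => scalarL2Sq (θ j t))
        (fun t => scalarL2Sq_nonneg _) (hs j)
        (fun a b ha hab => intervalIntegrable_of_forall_integrableOn_Ioc (hθi j) ha hab)]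
      exact hEθ j
    rw [meanEnergy_eq_longTimeAvgSup, longTimeAvgSup, limsup_congr hmean]
    exact longTimeAvgSup_add_le_add (fun t => integral_nonneg fun _ => sq_nonneg _)
      (fun t => scalarL2Sq_nonneg _) hAi hBi hEA hEB
  · /- MEAN DISSIPATION: `ε ≤ ⟨νⱼ‖∇θⱼ‖₂²⟩ = ⟨νⱼ‖∇θⱼ(·+sⱼ)‖₂²⟩ ≤ ⟨νⱼ‖∇uⱼ‖₂²⟩`, the right-hand
    running means being bounded by the Doering–Foias a-priori bound. -/
    have hLHu := hθ'LH j
    set F : ℝ → ℝ := fun t =>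
      ν j * (eGradNormSq (twoHalf (v j (t + s j)) (θ' j (t + s j)))).toReal with hF
    set G : ℝ → ℝ := fun t => ν j * (eScalarGradNormSq (θ j t)).toReal with hG
    have hF0 : ∀ t, 0 ≤ F t := fun t => mul_nonneg (hν j).le ENNReal.toReal_nonneg
    have hG0 : ∀ t, 0 ≤ G t := fun t => mul_nonneg (hν j).le ENNReal.toReal_nonneg
    -- `ε > 0` forces the scalar dissipation to be integrable on every `(0, T]` …
    have hGne : longTimeAvgSup G ≠ 0 := fun h0 => by
      have := hεle j
      rw [h0] at this
      exact absurd this (not_le.2 hε)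
    have hGi : ∀ T, 0 < T → IntegrableOn G (Ioc 0 T) := fun T _ =>
      ssl_integrableOn_Ioc_of_longTimeAvgSup_ne_zero hGne T
    -- … so its long-time average does not see the translation
    have hshift : longTimeAvgSup (fun t => G (t + s j)) = longTimeAvgSup G :=
      longTimeAvgSup_comp_add_right hG0 (hs j)
        (fun a b ha hab => intervalIntegrable_of_forall_integrableOn_Ioc hGi ha hab)
    -- the lift's dissipation is integrable on every `(0, T]` …
    have hFi : ∀ T, 0 < T → IntegrableOn F (Ioc 0 T) := fun T hT =>
      (intervalIntegrable_iff_integrableOn_Ioc_of_le hT.le).1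
        ((hLHu T hT).intervalIntegral_dissipation_eq hT).1
    -- … with running means bounded (Doering–Foias: steady mean-zero force, honest datum)
    have hFb : IsBoundedUnder (· ≤ ·) atTop (timeMean F) := by
      refine isBoundedUnder_timeMean_of_setIntegral_le_linear
        (A := 2 * kineticEnergy (twoHalf (v j (s j)) (θ' j (s j))))
        (B := 2 * ((4 * Real.pi ^ 2 * ν j)⁻¹ / 2 * ∫ x, ‖twoHalf g h x‖ ^ 2)) fun T hT => ?_
      have h1 := ((hLHu T hT).intervalIntegral_power_bounds hT (hν j) hf2 hfm).1
      rwa [intervalIntegral.integral_of_le hT.le] at h1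
    -- the translated scalar dissipation is dominated by the lift's, a.e. in time
    have hGF : ∀ T, 0 < T → ∀ᵐ t ∂(volume.restrict (Ioc 0 T)), G (t + s j) ≤ F t := by
      intro T hT
      have hLH := hLHu T hT
      have hfin : ∀ᵐ t ∂(volume.restrict (Ioc 0 T)),
          eGradNormSq (twoHalf (v j (t + s j)) (θ' j (t + s j))) < ∞ := by
        rw [← restrict_Ioo_eq_restrict_Ioc]
        exact ae_lt_top' hLH.aemeasurable_eGradNormSq hLH.lintegral_eGradNormSq_lt_top.ne
      filter_upwards [hfin, ae_restrict_mem measurableSet_Ioc, haeS j T hT] with t ht htmem hteq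
      have hvI : Integrable (v j (t + s j)) volume := (hv2 j t htmem.1.le).integrable one_le_two
      have hθI : Integrable (θ' j (t + s j)) volume :=
        (hθ'2 j t htmem.1.le).integrable one_le_two
      have hle : eScalarGradNormSq (θ' j (t + s j)) ≤
          eGradNormSq (twoHalf (v j (t + s j)) (θ' j (t + s j))) := by
        rw [eGradNormSq_twoHalf hvI hθI]
        exact le_add_self
      have hcongr : eScalarGradNormSq (θ j (t + s j)) = eScalarGradNormSq (θ' j (t + s j)) :=
        eScalarGradNormSq_congr_ae hteq.symm
      simp only [hF, hG]
      rw [hcongr]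
      exact mul_le_mul_of_nonneg_left (ENNReal.toReal_mono ht.ne hle) (hν j).le
    -- hence so are the running means, eventually
    have hmono : ∀ᶠ T in atTop, timeMean (fun t => G (t + s j)) T ≤ timeMean F T := by
      filter_upwards [eventually_gt_atTop (0 : ℝ)] with T hT
      exact timeMean_mono_ae hT.le hF0 (hFi T hT) (hGF T hT)
    calc ε ≤ longTimeAvgSup G := hεle j
      _ = longTimeAvgSup (fun t => G (t + s j)) := hshift.symm
      _ ≤ longTimeAvgSup F :=
          limsup_le_limsup hmono (isCoboundedUnder_le_timeMean_of_nonneg fun t => hG0 _) hFb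
      _ = meanDissipation (ν j) (fun t => twoHalf (v j (t + s j)) (θ' j (t + s j))) := rfl

end Summit.AnomalousDissipation.AnomalousDissipation.Theorems

end
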